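import Literature.NumberTheory.Weil1965.LocalQuadraticGaussTransformIntegrable
import HarnessLib

/-!
# Weil's decay estimate in `max(1, ‖β‖)^{-r/2}` currency (finite places)

Topic `NumberTheory/Weil1965`; namespace `Literature.NumberTheory.Weil1965`.  KERNEL mathematics only (theorems; no
definition, no named fact, no `axiom`, no proof hole).  A currency bridge for the consumers of
`LocalQuadraticFibreDensityDecay.lean`: the decay of the Gauss transform `G_Φ(β) = ∫ Φ(x) ψ(β f(x)) dμ^⊗ι` of a
Schwartz–Bruhat `Φ` along a diagonal non-degenerate `f = Σ cᵢ xᵢ²` (`r = card ι`), stated there in exponent form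
(`‖β‖ = q^{-j} ⟹ ‖G_Φ(β)‖ ≤ C (√q)^{r j}`), is restated for EVERY `β` as

  `‖G_Φ(β)‖ ≤ C · max(1, ‖β‖)^{-r/2}`      (`exists_norm_integral_mul_psiSqPi_le_max_rpow`),

Weil's own shape [Weil1965, Chap. I n° 2 Prop. 2] and the currency of the unramified exact factor
★ `norm_integral_indicator_piPrimePowBall_mul_psiSqPi_le_of_unramified` (constant `μ(𝒪)^r` there), so that the local
factors multiply over all places into the Euler-product majorant `Π_v max(1, |ξ|_v)^{-r/2}` of Weil's condition (B).

## References

* [Weil1965] A. Weil, *Sur la formule de Siegel dans la théorie des groupes classiques*, Acta Math. 113 (1965) 1–87: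
  Chap. I n° 2 Prop. 2 (p. 8).
-/

set_option autoImplicit false

noncomputable section

open MeasureTheory ValuativeRel Filter Topology Set
open scoped NNReal ENNReal Pointwise
open Literature.NumberTheory.GaloisRepresentations.IsNonarchimedeanLocalField
open Literature.NumberTheory.Automorphic
open Literature.NumberTheory.Weil1964

namespace Literature.NumberTheory.Weil1965

variable {F : Type*} [Field F] [ValuativeRel F] [TopologicalSpace F] [IsNonarchimedeanLocalField F]

section RpowCurrency

variable {ι : Type*} [Fintype ι] [MeasurableSpace F] [BorelSpace F] (μ : Measure F) [μ.IsAddHaarMeasure]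
  {ψ : AddChar F Circle}

omit [MeasurableSpace F] [BorelSpace F] in
/-- currency bridge: for `‖β‖ = q^{-j}` with `j ≤ 0`, `(√q)^{r j} = max(1, ‖β‖)^{-r/2}`. [folklore] -/
private theorem sqrt_zpow_eq_max_rpow {β : F} {j : ℤ} (hβ : normAbs F β = (residueFieldCard F : ℝ≥0)⁻¹ ^ j)
    (hj : j ≤ 0) (r : ℕ) :
    Real.sqrt (residueFieldCard F) ^ ((r : ℤ) * j) = ((max 1 (normAbs F β) : ℝ≥0) : ℝ) ^ (-((r : ℝ) / 2)) := by
  have hq0 : (0 : ℝ) < residueFieldCard F := by exact_mod_cast (one_lt_residueFieldCard F).le.trans_lt' zero_lt_one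
  have hβ1 : 1 ≤ normAbs F β := by
    rw [hβ, ← zpow_zero ((residueFieldCard F : ℝ≥0)⁻¹)]
    exact zpow_le_zpow_right_of_le_one₀ inv_residueFieldCard_pos inv_residueFieldCard_lt_one.le hj
  rw [max_eq_right hβ1, hβ, NNReal.coe_zpow, NNReal.coe_inv, NNReal.coe_natCast, Real.sqrt_eq_rpow, ← Real.rpow_intCast,
    ← Real.rpow_mul hq0.le]
  rw [← Real.rpow_intCast, ← Real.rpow_mul (inv_nonneg.2 hq0.le), Real.inv_rpow hq0.le, ← Real.rpow_neg hq0.le]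
  congr 1
  push_cast
  ring

/-- **WEIL'S DECAY ESTIMATE in `max(1, ‖β‖)` currency** [Weil1965, Chap. I n° 2 Prop. 2: "`|F*_Φ(x*)| ≤ C · sup(1, |x*|)^{-m/2}`"-shape]:
for a Schwartz–Bruhat `Φ` on `F^ι` and a diagonal non-degenerate `f = Σ cᵢ xᵢ²` there is `C ≥ 0` with
`‖∫ Φ(x) ψ(β f(x)) dμ^⊗ι‖ ≤ C · max(1, ‖β‖)^{-r/2}` for EVERY `β ∈ F` (`r = card ι`) — the exponent form
★ `exists_norm_integral_mul_psiSqPi_le_of_mem_schwartzBruhat` for `‖β‖ ≥ 1` joined with the trivial bound `∫ ‖Φ‖` for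
`‖β‖ ≤ 1`; same currency as the unramified exact factor ★ `norm_integral_indicator_piPrimePowBall_mul_psiSqPi_le_of_unramified`.
[cite: Weil1965, Chap. I n° 2 Prop. 2, p. 8] -/
theorem exists_norm_integral_mul_psiSqPi_le_max_rpow {d : ℤ} (hd : ψ.HasConductorExp d) {v₂ : ℤ}
    (h2 : normAbs F (2 : F) = (residueFieldCard F : ℝ≥0)⁻¹ ^ v₂) {c : ι → F} (hc : ∀ i, c i ≠ 0)
    {Φ : (ι → F) → ℂ} (hΦ : Φ ∈ SchwartzBruhat (ι → F)) :
    ∃ C : ℝ, 0 ≤ C ∧ ∀ β : F,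
      ‖∫ x, Φ x * psiSqPi ψ (fun i => β * c i) x ∂(Measure.pi fun _ : ι => μ)‖ ≤
        C * ((max 1 (normAbs F β) : ℝ≥0) : ℝ) ^ (-((Fintype.card ι : ℝ) / 2)) := by
  have hψ : Continuous ψ := continuous_of_hasConductorExp hd
  obtain ⟨C₁, hC₁0, hC₁⟩ := exists_norm_integral_mul_psiSqPi_le_of_mem_schwartzBruhat μ hd h2 hc hΦ
  set C₀ : ℝ := ∫ x, ‖Φ x‖ ∂(Measure.pi fun _ : ι => μ) with hC₀def
  have hC₀0 : 0 ≤ C₀ := integral_nonneg fun _ => norm_nonneg _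
  have hC₀ : ∀ β, ‖∫ x, Φ x * psiSqPi ψ (fun i => β * c i) x ∂(Measure.pi fun _ : ι => μ)‖ ≤ C₀ := fun β =>
    norm_integral_mul_psiSqPi_le μ c (integrable_of_mem_schwartzBruhat_pi μ hψ hΦ) β
  refine ⟨max C₀ C₁, le_max_of_le_left hC₀0, fun β => ?_⟩
  by_cases hβ0 : β = 0
  · subst hβ0
    rw [map_zero, max_eq_left zero_le_one, NNReal.coe_one, Real.one_rpow, mul_one]
    exact (hC₀ 0).trans (le_max_left _ _)
  obtain ⟨j, hj⟩ := exists_normAbs_eq_inv_zpow hβ0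
  rcases le_or_gt j 0 with hj0 | hj0
  · rw [← sqrt_zpow_eq_max_rpow hj hj0]
    exact (hC₁ β j hj).trans (mul_le_mul_of_nonneg_right (le_max_right _ _)
      (zpow_nonneg (Real.sqrt_nonneg _) _))
  · have hβ1 : normAbs F β ≤ 1 := by
      rw [hj, ← zpow_zero ((residueFieldCard F : ℝ≥0)⁻¹)]
      exact zpow_le_zpow_right_of_le_one₀ inv_residueFieldCard_pos inv_residueFieldCard_lt_one.le hj0.le
    rw [max_eq_left hβ1, NNReal.coe_one, Real.one_rpow, mul_one]
    exact (hC₀ β).trans (le_max_left _ _)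

end RpowCurrency

end Literature.NumberTheory.Weil1965
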